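/-
Width seat `ym-line-cbag-p1-w3` (prover-ym-line-cbag-p1-w3-g8-0; own items stmt-QuantumFields-22254 / 22893 CLOSED proved), helping LINE 3
`route-QuantumFields-SixPlaneColdBox` (crux stmt-QuantumFields-25709 `DensityTransferG`): real-analysis bookkeeping for the six-plane DLR
transfer with slack (`SixPlaneColdBoxTransferWithSlack`).
-/
import Summits.QuantumFields.YangMills.Theorems.WeakCouplingRatesBulkDominatesColdBoxWDlrPlumbing
import Summits.QuantumFields.YangMills.Theorems.WeakCouplingRatesEventuallyPow
import Summits.QuantumFields.YangMills.Theorems.WeakCouplingRates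

/-!
# Route `SixPlaneColdBox`, crux `DensityTransferG`: bookkeeping lemmas for the transfer with slack

Elementary real-analysis facts used by `SixPlaneColdBox.sixPlaneTransferWithSlack_of_torusMeanNear`
(`Theorems/SixPlaneColdBoxTransferWithSlack.lean`): positive parts against indicators, eventual domination of monomials (with or without the
large-field factor `e^{−β^δ}`) by a target power, double affine sums over the six planes, the bad-mass count against a power of `β`, and
`⌈β^A⌉/⌈β^θ⌉ ≤ 2β^{A−θ}`.  No sorry; no definition; standard axioms.  NOT a claim about the Yang–Mills mass gap.
-/

set_option autoImplicit false

noncomputable section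

open MeasureTheory Finset Real Filter Topology
open Summit.QuantumFields.YangMills.Theorems.WeakCouplingRates

namespace Summit.QuantumFields.YangMills.Theorems.SixPlaneColdBox

/-! ## Real bookkeeping -/

/-- `max x 0 ≤ x + C·𝟙_E` when `x ≥ 0` off `E` and `|x| ≤ C`. -/
theorem max_zero_le_add_indicator {Ω : Type*} (E : Set Ω) {f : Ω → ℝ} {C : ℝ} (hf : ∀ ω, ω ∉ E → 0 ≤ f ω)
    (hC : ∀ ω, |f ω| ≤ C) (ω : Ω) : max (f ω) 0 ≤ f ω + C * E.indicator (fun _ => (1 : ℝ)) ω := by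
  by_cases hω : ω ∈ E
  · rw [Set.indicator_of_mem hω, mul_one]
    have h := hC ω
    rw [abs_le] at h
    rcases le_or_gt 0 (f ω) with h0 | h0
    · rw [max_eq_left h0]; linarith
    · rw [max_eq_right h0.le]; linarith
  · rw [Set.indicator_of_notMem hω, mul_zero, add_zero, max_eq_left (hf ω hω)]

/-- A monomial with an exponent gap is eventually below a target power divided by `n`. -/
theorem eventually_const_rpow_le_rpow_div {C a b n : ℝ} (hab : a < b) (hn : 0 < n) :
    ∀ᶠ β : ℝ in atTop, C * β ^ a ≤ β ^ b / n := by
  obtain ⟨β₀, hβ₀1, h⟩ := exists_const_mul_rpow_le_rpow (n * C) hab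
  filter_upwards [eventually_ge_atTop β₀] with β hβ
  have := h β hβ
  rw [le_div_iff₀ hn]; linarith

/-- A monomial times `e^{−β^δ}` is eventually below a target power divided by `n`. -/
theorem eventually_const_rpow_exp_le_rpow_div {C s b n δ : ℝ} (hδ : 0 < δ) (hn : 0 < n) :
    ∀ᶠ β : ℝ in atTop, C * (β ^ s * Real.exp (-(β ^ δ))) ≤ β ^ b / n := by
  have ht := (tendsto_rpow_mul_exp_neg_rpow (s - b) hδ).const_mul (n * |C|)
  rw [mul_zero] at ht
  filter_upwards [ht.eventually (gt_mem_nhds one_pos), eventually_gt_atTop (0 : ℝ)] with β hβ hβ0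
  have hb : 0 < β ^ b := Real.rpow_pos_of_pos hβ0 _
  have e : β ^ s = β ^ (s - b) * β ^ b := by rw [← Real.rpow_add hβ0]; ring_nf
  rw [le_div_iff₀ hn, e]
  have h1 : C * (β ^ (s - b) * β ^ b * Real.exp (-(β ^ δ))) * n =
      (n * C * (β ^ (s - b) * Real.exp (-(β ^ δ)))) * β ^ b := by ring
  rw [h1]
  have h2 : n * C * (β ^ (s - b) * Real.exp (-(β ^ δ))) ≤ n * |C| * (β ^ (s - b) * Real.exp (-(β ^ δ))) :=
    mul_le_mul_of_nonneg_right (mul_le_mul_of_nonneg_left (le_abs_self C) hn.le) (by positivity)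
  nlinarith

/-- Double sums of an affine expression in two one-variable families. -/
theorem sum_sum_affine {ι : Type*} [Fintype ι] (a b : ι → ℝ) (c d : ℝ) :
    ∑ q : ι, ∑ q' : ι, (c * (a q + b q') + d) =
      c * (Fintype.card ι : ℝ) * (∑ q, a q + ∑ q, b q) + (Fintype.card ι : ℝ) ^ 2 * d := by
  simp only [mul_add, Finset.sum_add_distrib, Finset.sum_const, Finset.card_univ, nsmul_eq_mul, ← Finset.mul_sum]
  ring

/-- The bad-mass count against a power: `6(2H+3)⁴e^{−β^δ} ≤ 6·2401·β^{4θ}e^{−β^δ}` when `H ≤ 2β^θ`, `β ≥ 1`. -/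
theorem badMass_le_rpow {β θ δ : ℝ} {H : ℕ} (hβ1 : 1 ≤ β) (hθ : 0 ≤ θ) (hH2 : (H : ℝ) ≤ 2 * β ^ θ) :
    ((6 * (2 * H + 3) ^ 4 : ℕ) : ℝ) * Real.exp (-(β ^ δ)) ≤ 6 * 2401 * (β ^ (4 * θ) * Real.exp (-(β ^ δ))) := by
  have hβ0 : 0 < β := by linarith
  have h1 : (1 : ℝ) ≤ β ^ θ := Real.one_le_rpow hβ1 hθ
  have h7 : (2 * (H : ℝ) + 3) ≤ 7 * β ^ θ := by linarith
  have h74 : (2 * (H : ℝ) + 3) ^ 4 ≤ (7 * β ^ θ) ^ 4 := pow_le_pow_left₀ (by positivity) h7 4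
  have e4 : (7 * β ^ θ) ^ 4 = 2401 * β ^ (4 * θ) := by
    rw [mul_pow, ← Real.rpow_natCast (β ^ θ) 4, ← Real.rpow_mul hβ0.le]; norm_num; ring_nf
  rw [e4] at h74
  have hexp0 : 0 ≤ Real.exp (-(β ^ δ)) := (Real.exp_pos _).le
  push_cast
  nlinarith [mul_le_mul_of_nonneg_right h74 hexp0]

/-- `⌈β^A⌉/⌈β^θ⌉ ≤ 2β^{A−θ}` for `β ≥ 1`, `A ≥ 0`. -/
theorem ceil_div_ceil_le_rpow {β A θ : ℝ} (hβ1 : 1 ≤ β) (hA : 0 ≤ A) :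
    (⌈β ^ A⌉₊ : ℝ) / (⌈β ^ θ⌉₊ : ℝ) ≤ 2 * β ^ (A - θ) := by
  have hβ0 : 0 < β := by linarith
  have hT2 : (⌈β ^ A⌉₊ : ℝ) ≤ 2 * β ^ A := (one_le_ceil_rpow_and_le hβ1 hA).2
  have hθpos : 0 < β ^ θ := Real.rpow_pos_of_pos hβ0 θ
  have hHge : β ^ θ ≤ (⌈β ^ θ⌉₊ : ℝ) := Nat.le_ceil _
  have hHpos : (0 : ℝ) < (⌈β ^ θ⌉₊ : ℝ) := lt_of_lt_of_le hθpos hHge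
  rw [div_le_iff₀ hHpos]
  calc (⌈β ^ A⌉₊ : ℝ) ≤ 2 * β ^ A := hT2
    _ = 2 * β ^ (A - θ) * β ^ θ := by rw [Real.rpow_sub hβ0]; field_simp
    _ ≤ 2 * β ^ (A - θ) * (⌈β ^ θ⌉₊ : ℝ) := by gcongr


end Summit.QuantumFields.YangMills.Theorems.SixPlaneColdBox

end
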